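import Summits.QuantumFields.YangMills.Theorems.UnitScaleGibbsCollarPairingZd
import Summits.QuantumFields.YangMills.Theorems.UnitScaleGibbsLinProxyFluxIdentification
import Summits.QuantumFields.YangMills.Theorems.UnitScaleGibbsOnEventHessianAxialGauge
import Summits.QuantumFields.YangMills.Theorems.CovariantDischargeCutoffCommutator
import HarnessLib

/-!
# `GrossTransferStubLinTestCollarTerm` — KNIT-E4 (R8-P7): THE COLLAR TERM OF `stub_linTest`'s POINTWISE PACKAGE, ONE REAL INEQUALITY
# (LINE 28 «GrossTransfer» v3.2, skeleton of record `Cruxes/HistoryTailL/Lines/gross_transfer.lean`; crux `RevelationMartingale.MeanDeviationL`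
# stmt-QuantumFields-23083 ∕ `UnitScaleTilt.HistoryTailL` stmt-QuantumFields-19936)

Cell `ym3-torus` (YM ladder rung R3 = continuum SU(2) Yang–Mills on T³ — a RUNG, NOT the Clay problem: not d = 4, not infinite volume, not a
mass gap); width seat `ym3-torus-px19` (gen 11), helper `--supports stmt-QuantumFields-23083` for the pen of record ★w2-19936 (KNIT-PLAN v3,
23083 evidence #19, row (P7) «collar: KNIT-E4 over ✓KNIT-B»; norm-scope rule: P5∕P6∕P7 as separate `Matrix.Norms.L2Operator`-scoped files
exporting REAL inequalities, the Frobenius-scoped package only combines).  THEOREMS ONLY (0 `def`, 0 `sorry`, default heartbeats).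

WHAT.  In the pen's `main_estimate` the (Z-e) cutoff-potential identity (P4) leaves the COLLAR TERM `Σ_{y∈Q_{3R+2}(z₀)} Σ_μ Σ_ν σ(y,μ,ν)·F̂^α(y,μ,ν)`,
`σ := E₁ − C₂` (the two cutoff commutators, antisymmetric in `(μ,ν)`, supported in `Q_{3R+1}(z₀)`), `F̂^α` the antisymmetrised Pauli read-out of the
dressed plaquette variables `F^α_p = Re tr((iσ_α)(V(∂p) − 1))`, `V = U^{axialGauge U lo hi}`.  ✓KNIT-B `UnitScaleGibbsCollarPairingZd.sq_half_sum_mul_le`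
is the `ℤ^d` algebra `(½ΣΣ σ·F)² ≤ 2·(Σ|δ₂σ|)·(Σ|δ₂σ|·g²) + ½·ε²·(ΣΣ|σ|)²` for ANY `F` with `|F − d₁g| ≤ ε`; this file instantiates it at the read-out:
`g(y,ν) := Re tr((iσ_α)(↑V⟨castSite y, ν⟩ − 1))`, `ε := 44η²` (✓LIN-ID `UnitScaleGibbsLinProxyFluxIdentification.abs_re_trace_plaq_sub_curl_le`:
the Pauli trace of a plaquette is the lattice curl of `g` to second order when its four bonds are within `η ≤ 1` of `1`), and reads `g² ≤ 16·‖↑V_b − 1‖²`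
(✓`abs_re_trace_le_two_mul_norm`, ✓`norm_I_smul_pauli_le_two`), so that the right-hand side is the pen's `ω`-term `Σ|δ₂σ|·dist₁(V_b)²` plus a window-small
square:
* §1 `sq_re_trace_pauli_mul_le` (`(Re tr(τ_α X))² ≤ 16‖X‖²`);
* §2 ★`abs_readout_sub_curl_le` — for `y ∈ Q_{S−1}(z)` and ALL `μ, ν` (diagonal and reversed pairs included, by antisymmetry):
  `|F̂^α(y,μ,ν) − (d₁g)(y,μ,ν)| ≤ 44η²` whenever `‖↑V⟨castSite x, κ⟩ − 1‖ ≤ η` for `x ∈ Q_S(z)` (the slot dictionary `slotBond ⟨castSite y, μ, ν⟩ =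
  (⟨y,μ⟩, ⟨y+e_μ,ν⟩, ⟨y+e_ν,μ⟩, ⟨y,ν⟩)` through ✓`castSite_add_e`);
* §3 ★★`collar_term_sq_le` — SUPPORT-AGNOSTIC edition (any `SU(2)` field `V`, any centre `z`, radius `S`, smallness only on `Q_S(z)`):
  `(Σ_{Q_S}ΣΣ σ·F̂^α)² ≤ 128·(Σ_{Q_S}Σ_ν|δ₂σ|)·(Σ_{Q_S}Σ_ν |δ₂σ(y,ν)|·‖↑V⟨castSite y,ν⟩ − 1‖²) + 2·(44η²·Σ_{Q_S}ΣΣ|σ|)²`;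
* §4 ★★★`collar_term_sq_le_axial` — THE PEN's CONTEXT (`PlaqSmallOn (boxPlaqs lo hi) θ U`, `hi ≤ lo + n`, `n < sitesPerDir`, `lo = z₀ − (3R+2)`,
  `hi = z₀ + (3R+4)`, `V := U^{axialGauge U lo hi}`, `S := 3R+2`, `η := (d−1)·n·θ ≤ 1` by ✓`norm_gaugeAct_axialGauge_sub_one_le`), right-hand side in
  `dist₁` letters: `… ≤ 128·W_S·(Σ_{Q_{3R+2}}Σ_ν |δ₂σ(y,ν)|·dist₁(V⟨castSite y,ν⟩)²) + 2·(44((d−1)nθ)²·ΣΣΣ|σ|)²`, `W_S := Σ_{Q_{3R+2}}Σ_ν|δ₂σ|`.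
* §5 `sigma_antisymm` ∕ ★`sigma_eq_zero_of_not_mem` — the two `σ`-rows of §4 FROM THE PEN's DEFINING LETTERS (`E₁`, `C₂`, `σ := E₁ − C₂`, `γt = d₂βt` with `βt`
  antisymmetric, `χ = 0` off `Q_{3R}(z₀)`; ✓`dTwo_swap_right`, ✓`curl_comm_eq_zero_of_not_mem_box`, ✓`bdiff_comm_eq_zero_of_not_mem_box`) and ★★★`collar_term_sq_le_of_letters` =
  §4 with those two rows discharged (binders = the skeleton's `hβt`-antisymmetry, `hγt`, `hχ0`, `hE1`, `hC2`, `hσ`, `hδσ`).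
The torus read-back `Σ_b ω_b·dist₁(V_b)² = 192·W·Σ_{Q}Σ_ν|δ₂σ|·dist₁²` stays in the pen's push letters ((S3)∕(R7)); the factor-2 pitfall of the plan
(«the collar identity's ½ΣΣ σ·F̂ enters hP4 un-halved») is why the UN-HALVED sum is squared here (`= 4 ×` KNIT-B).

HONEST SCOPE.  Deterministic `2 × 2`-matrix ∕ finite-sum algebra about ONE configuration; proves no stub: `stub_linTest`, its pointwise package,
`stub_meanDeviationDeep`, `MeanDeviationL` 23083, `MeanDeviationDeepL` 23134, `HistoryTailL` 19936, K1∕K2, the rung `YM3TorusSU2` are NOT proved; no summit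
statement is proved; the Yang–Mills mass gap is NOT proved.
References: [GrossCMP1983] Thm 2.2 (convergence of lattice gauge theory observables via summation by parts — the collar bookkeeping);
[Balaban1985Averaging] (19) p. 21 (`dist₁` and the small-field bond letters); [Balaban1984PropagatorsII] (1.9) p. 226 (lattice difference operators).
-/

noncomputable section

set_option autoImplicit false

open scoped BigOperators Matrix.Norms.L2Operator
open Complex Finset
open Literature.MathematicalPhysics.QuantumFieldTheory.Balaban1983to89
open Literature.MathematicalPhysics.QuantumFieldTheory.Balaban1983to89.B4Eq19LatticeOperators (Zd unitVec box mem_box box_mono add_unitVec_mem_box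
  abs_unitVec_apply_le)
open Literature.MathematicalPhysics.QuantumFieldTheory.Balaban1983to89.T4AxialGaugeSmallField (castSite castSite_add_e boxPlaqs boxBonds axialGauge)
open Literature.MathematicalPhysics.QuantumFieldTheory.Balaban1983to89.B7Prop1Explicit (e)
open Literature.MathematicalPhysics.QuantumFieldTheory.Balaban1983to89.B10Eq18SigmaSU2 (pauli)
open Summit.QuantumFields.YangMills.Theorems.UnitScaleGibbsActionDerivativeSlotCalculus (slotBond)
open Summit.QuantumFields.YangMills.Theorems.UnitScaleGibbsLinProxySU2Letters (abs_re_trace_le_two_mul_norm conjTranspose_I_smul_pauli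
  norm_I_smul_pauli_le_two)
open Summit.QuantumFields.YangMills.Theorems.UnitScaleGibbsLinProxyFluxIdentification (abs_re_trace_plaq_sub_curl_le)
open Summit.QuantumFields.YangMills.Theorems.UnitScaleGibbsCollarPairingZd (sq_half_sum_mul_le)
open Summit.QuantumFields.YangMills.Theorems.UnitScaleGibbsOnEventHessianAxialGauge (norm_gaugeAct_axialGauge_sub_one_le)
open Summit.QuantumFields.YangMills.Theorems.CovariantDischargeLatticeFormsDeg23 (dTwo_swap_right)
open Summit.QuantumFields.YangMills.Theorems.CovariantDischargeCutoffCommutator (curl_comm_eq_zero_of_not_mem_box bdiff_comm_eq_zero_of_not_mem_box)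

namespace Summit.QuantumFields.YangMills.Theorems.GrossTransferStubLinTestCollarTerm

variable {P : Params} {j : ℕ}

/-! ## §1 The Pauli read-out is controlled by the bond deviation -/

/-- `(Re tr(τ_α X))² ≤ 16·‖X‖²` for `τ_α = iσ_α` (`|Re tr Y| ≤ 2‖Y‖` on `2 × 2` matrices, `‖τ_α‖ ≤ 2`). [folklore] -/
theorem sq_re_trace_pauli_mul_le (α : Fin 3) (X : Matrix (Fin 2) (Fin 2) ℂ) :
    ((I • pauli α) * X).trace.re ^ 2 ≤ 16 * ‖X‖ ^ 2 := by
  have h1 : |((I • pauli α) * X).trace.re| ≤ 4 * ‖X‖ := by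
    calc |((I • pauli α) * X).trace.re| ≤ 2 * ‖(I • pauli α) * X‖ := abs_re_trace_le_two_mul_norm _
      _ ≤ 2 * (‖I • pauli α‖ * ‖X‖) := by gcongr; exact Matrix.l2_opNorm_mul _ _
      _ ≤ 2 * (2 * ‖X‖) := by gcongr; exact norm_I_smul_pauli_le_two α
      _ = 4 * ‖X‖ := by ring
  have h0 : 0 ≤ ‖X‖ := norm_nonneg _
  nlinarith [sq_abs (((I • pauli α) * X).trace.re), abs_nonneg (((I • pauli α) * X).trace.re), h1, h0]

/-- The bond read-out `g = Re tr(τ_α(↑W − 1))` of an `SU(2)` variable: `g² ≤ 16·dist₁(W)²` (`dist₁ = ‖· − 1‖`, ✓`FederbushMean.dist1_SU_eq`).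
[cite: Balaban1985Averaging, (19) p.21] -/
theorem sq_readout_le_dist1_sq (α : Fin 3) (W : Matrix.specialUnitaryGroup (Fin 2) ℂ) :
    ((I • pauli α) * ((W : Matrix (Fin 2) (Fin 2) ℂ) - 1)).trace.re ^ 2 ≤ 16 * GaugeGroup.dist1 W ^ 2 := by
  rw [FederbushMean.dist1_SU_eq]
  exact sq_re_trace_pauli_mul_le α _

/-! ## §2 The antisymmetrised plaquette read-out is the lattice curl of the bond read-out, to second order -/

/-- The slot bonds of the torus plaquette `⟨castSite y, μ, ν⟩` in `ℤ^d` letters: `(⟨y,μ⟩, ⟨y+e_μ,ν⟩, ⟨y+e_ν,μ⟩, ⟨y,ν⟩)` (✓`castSite_add_e`). [folklore] -/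
theorem slotBond_castSite (y : Zd P.d) {μ ν : Fin P.d} (h : μ < ν) :
    slotBond (⟨castSite y, μ, ν, h⟩ : Plaq P j) 0 = ⟨castSite y, μ⟩ ∧
    slotBond (⟨castSite y, μ, ν, h⟩ : Plaq P j) 1 = ⟨castSite (y + unitVec μ), ν⟩ ∧
    slotBond (⟨castSite y, μ, ν, h⟩ : Plaq P j) 2 = ⟨castSite (y + unitVec ν), μ⟩ ∧
    slotBond (⟨castSite y, μ, ν, h⟩ : Plaq P j) 3 = ⟨castSite y, ν⟩ := by
  refine ⟨rfl, ?_, ?_, rfl⟩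
  · show (⟨(castSite y : Site P j).shift μ, ν⟩ : PBond P j) = ⟨castSite (y + unitVec μ), ν⟩
    rw [show (unitVec μ : Zd P.d) = e μ from rfl, castSite_add_e]
  · show (⟨(castSite y : Site P j).shift ν, μ⟩ : PBond P j) = ⟨castSite (y + unitVec ν), μ⟩
    rw [show (unitVec ν : Zd P.d) = e ν from rfl, castSite_add_e]

/-- ★ **THE READ-OUT ROW `|F̂^α − d₁g| ≤ 44η²` ON A BOX, ALL INDEX PAIRS.**  `V` an `SU(2)` field whose bonds `⟨castSite x, κ⟩`, `x ∈ Q_S(z)`, are within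
`η ≤ 1` of `1`; `F̂^α` given by its `μ < ν` row (the Pauli trace of `V(∂⟨castSite y, μ, ν⟩) − 1`) and antisymmetry; `g(y,ν) = Re tr(τ_α(↑V⟨castSite y,ν⟩ − 1))`.
Then for `y ∈ Q_{S−1}(z)` and every `μ, ν`: `|F̂^α(y,μ,ν) − ((g(y+e_μ,ν) − g(y,ν)) − (g(y+e_ν,μ) − g(y,μ)))| ≤ 44η²`. [cite: GrossCMP1983, proof of Thm 2.2] -/
theorem abs_readout_sub_curl_le (V : GaugeField P j (Matrix.specialUnitaryGroup (Fin 2) ℂ)) (α : Fin 3) (z : Zd P.d) (S : ℤ)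
    {η : ℝ} (hη0 : 0 ≤ η) (hη1 : η ≤ 1)
    (hV : ∀ x ∈ box z S, ∀ κ, ‖((V ⟨castSite x, κ⟩ : Matrix.specialUnitaryGroup (Fin 2) ℂ) : Matrix (Fin 2) (Fin 2) ℂ) - 1‖ ≤ η)
    (Fh : Zd P.d → Fin P.d → Fin P.d → ℝ)
    (hFh : ∀ y (μ ν : Fin P.d) (h : μ < ν), Fh y μ ν =
      ((I • pauli α) * (((GaugeField.plaqHol V ⟨castSite y, μ, ν, h⟩ : Matrix.specialUnitaryGroup (Fin 2) ℂ) :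
        Matrix (Fin 2) (Fin 2) ℂ) - 1)).trace.re)
    (hFha : ∀ y μ ν, Fh y ν μ = -Fh y μ ν)
    (g : Zd P.d → Fin P.d → ℝ)
    (hg : ∀ y ν, g y ν = ((I • pauli α) * (((V ⟨castSite y, ν⟩ : Matrix.specialUnitaryGroup (Fin 2) ℂ) : Matrix (Fin 2) (Fin 2) ℂ) - 1)).trace.re)
    {y : Zd P.d} (hy : y ∈ box z (S - 1)) (μ ν : Fin P.d) :
    |Fh y μ ν - ((g (y + unitVec μ) ν - g y ν) - (g (y + unitVec ν) μ - g y μ))| ≤ 44 * η ^ 2 := by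
  -- the three sites carrying the four slot bonds lie in `Q_S(z)`
  have hy0 : y ∈ box z S := box_mono z (show S - 1 ≤ S by linarith) hy
  have hyμ : ∀ κ : Fin P.d, y + unitVec κ ∈ box z S := fun κ => by
    have := add_unitVec_mem_box hy κ; rwa [sub_add_cancel] at this
  -- the `μ < ν` case is LIN-ID at `τ := iσ_α` through the slot dictionary
  have hlt : ∀ {μ ν : Fin P.d} (h : μ < ν),
      |Fh y μ ν - ((g (y + unitVec μ) ν - g y ν) - (g (y + unitVec ν) μ - g y μ))| ≤ 44 * η ^ 2 := by
    intro μ ν h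
    obtain ⟨h0, h1, h2, h3⟩ := slotBond_castSite (P := P) (j := j) y h
    have hVs : ∀ i : Fin 4, ‖((V (slotBond (⟨castSite y, μ, ν, h⟩ : Plaq P j) i) : Matrix.specialUnitaryGroup (Fin 2) ℂ) :
        Matrix (Fin 2) (Fin 2) ℂ) - 1‖ ≤ η := by
      intro i
      fin_cases i
      · show ‖((V (slotBond (⟨castSite y, μ, ν, h⟩ : Plaq P j) 0) : Matrix.specialUnitaryGroup (Fin 2) ℂ) :
          Matrix (Fin 2) (Fin 2) ℂ) - 1‖ ≤ η
        rw [h0]; exact hV y hy0 μ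
      · show ‖((V (slotBond (⟨castSite y, μ, ν, h⟩ : Plaq P j) 1) : Matrix.specialUnitaryGroup (Fin 2) ℂ) :
          Matrix (Fin 2) (Fin 2) ℂ) - 1‖ ≤ η
        rw [h1]; exact hV _ (hyμ μ) ν
      · show ‖((V (slotBond (⟨castSite y, μ, ν, h⟩ : Plaq P j) 2) : Matrix.specialUnitaryGroup (Fin 2) ℂ) :
          Matrix (Fin 2) (Fin 2) ℂ) - 1‖ ≤ η
        rw [h2]; exact hV _ (hyμ ν) μ
      · show ‖((V (slotBond (⟨castSite y, μ, ν, h⟩ : Plaq P j) 3) : Matrix.specialUnitaryGroup (Fin 2) ℂ) :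
          Matrix (Fin 2) (Fin 2) ℂ) - 1‖ ≤ η
        rw [h3]; exact hV y hy0 ν
    have key := abs_re_trace_plaq_sub_curl_le V ⟨castSite y, μ, ν, h⟩ (I • pauli α) (conjTranspose_I_smul_pauli α)
      (norm_I_smul_pauli_le_two α) hη0 hη1 hVs
    rw [h0, h1, h2, h3] at key
    rw [hFh y μ ν h, hg, hg, hg, hg]
    have e4 : ∀ a b c d f : ℝ, f - ((b - d) - (c - a)) = f - (a + b - c - d) := fun a b c d f => by ring
    rw [e4]
    exact key
  rcases lt_trichotomy μ ν with h | h | h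
  · exact hlt h
  · subst h
    have h0 : Fh y μ μ = 0 := by have := hFha y μ μ; linarith
    have e0 : Fh y μ μ - ((g (y + unitVec μ) μ - g y μ) - (g (y + unitVec μ) μ - g y μ)) = 0 := by rw [h0]; ring
    rw [e0, abs_zero]; positivity
  · have := hlt h
    rw [hFha y ν μ]
    have e1 : -Fh y ν μ - ((g (y + unitVec μ) ν - g y ν) - (g (y + unitVec ν) μ - g y μ)) =
        -(Fh y ν μ - ((g (y + unitVec ν) μ - g y μ) - (g (y + unitVec μ) ν - g y ν))) := by ring
    rw [e1, abs_neg]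
    exact this

/-! ## §3 The collar term, support-agnostic edition -/

/-- ★★ **KNIT-E4, SUPPORT-AGNOSTIC — THE COLLAR TERM SQUARED.**  `σ` antisymmetric in `(μ,ν)` and vanishing off `Q_{S−1}(z)`, `δ₂σ(y,ν) = Σ_μ(σ(y−e_μ,μ,ν) − σ(y,μ,ν))`,
`V` an `SU(2)` field with `‖↑V⟨castSite x,κ⟩ − 1‖ ≤ η ≤ 1` for `x ∈ Q_S(z)`, `F̂^α` the antisymmetrised Pauli read-out (two rows).  Then
`(Σ_{Q_S}Σ_μΣ_ν σ·F̂^α)² ≤ 128·(Σ_{Q_S}Σ_ν|δ₂σ|)·(Σ_{Q_S}Σ_ν |δ₂σ(y,ν)|·‖↑V⟨castSite y,ν⟩ − 1‖²) + 2·(44η²·Σ_{Q_S}ΣΣ|σ|)²`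
(✓KNIT-B at `ε := 44η²`, `× 4` for the un-halved sum, `g² ≤ 16‖↑V − 1‖²`). [cite: GrossCMP1983, Thm 2.2] -/
theorem collar_term_sq_le (V : GaugeField P j (Matrix.specialUnitaryGroup (Fin 2) ℂ)) (α : Fin 3)
    (σ : Zd P.d → Fin P.d → Fin P.d → ℝ) (δσ : Zd P.d → Fin P.d → ℝ) (z : Zd P.d) (S : ℤ) {η : ℝ} (hη0 : 0 ≤ η) (hη1 : η ≤ 1)
    (hanti : ∀ x μ ν, σ x ν μ = -σ x μ ν) (hσ0 : ∀ y ∉ box z (S - 1), ∀ μ ν, σ y μ ν = 0)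
    (hδσ : ∀ y ν, δσ y ν = ∑ μ, (σ (y - unitVec μ) μ ν - σ y μ ν))
    (hV : ∀ x ∈ box z S, ∀ κ, ‖((V ⟨castSite x, κ⟩ : Matrix.specialUnitaryGroup (Fin 2) ℂ) : Matrix (Fin 2) (Fin 2) ℂ) - 1‖ ≤ η)
    (Fh : Zd P.d → Fin P.d → Fin P.d → ℝ)
    (hFh : ∀ y (μ ν : Fin P.d) (h : μ < ν), Fh y μ ν =
      ((I • pauli α) * (((GaugeField.plaqHol V ⟨castSite y, μ, ν, h⟩ : Matrix.specialUnitaryGroup (Fin 2) ℂ) :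
        Matrix (Fin 2) (Fin 2) ℂ) - 1)).trace.re)
    (hFha : ∀ y μ ν, Fh y ν μ = -Fh y μ ν) :
    (∑ y ∈ box z S, ∑ μ, ∑ ν, σ y μ ν * Fh y μ ν) ^ 2
      ≤ 128 * ((∑ y ∈ box z S, ∑ ν, |δσ y ν|) *
            ∑ y ∈ box z S, ∑ ν, |δσ y ν| * ‖((V ⟨castSite y, ν⟩ : Matrix.specialUnitaryGroup (Fin 2) ℂ) : Matrix (Fin 2) (Fin 2) ℂ) - 1‖ ^ 2)
        + 2 * (44 * η ^ 2 * ∑ y ∈ box z S, ∑ μ, ∑ ν, |σ y μ ν|) ^ 2 := by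
  classical
  -- the bond read-out `g` and its curl `dg`
  obtain ⟨g, hg⟩ : ∃ g : Zd P.d → Fin P.d → ℝ, ∀ y ν, g y ν =
      ((I • pauli α) * (((V ⟨castSite y, ν⟩ : Matrix.specialUnitaryGroup (Fin 2) ℂ) : Matrix (Fin 2) (Fin 2) ℂ) - 1)).trace.re :=
    ⟨_, fun _ _ => rfl⟩
  obtain ⟨dg, hdg⟩ : ∃ dg : Zd P.d → Fin P.d → Fin P.d → ℝ, ∀ x μ ν,
      dg x μ ν = (g (x + unitVec μ) ν - g x ν) - (g (x + unitVec ν) μ - g x μ) := ⟨_, fun _ _ _ => rfl⟩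
  -- the read-out, patched to `dg` off `Q_{S−1}` (where `σ = 0`), so that KNIT-B's `hF` holds on all of `Q_S`
  obtain ⟨F', hF'⟩ : ∃ F' : Zd P.d → Fin P.d → Fin P.d → ℝ, ∀ y μ ν,
      F' y μ ν = if y ∈ box z (S - 1) then Fh y μ ν else dg y μ ν := ⟨_, fun _ _ _ => rfl⟩
  have hε0 : 0 ≤ 44 * η ^ 2 := by positivity
  have hF'row : ∀ y ∈ box z S, ∀ μ ν, |F' y μ ν - dg y μ ν| ≤ 44 * η ^ 2 := by
    intro y _ μ ν
    rw [hF']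
    split_ifs with hy
    · rw [hdg]; exact abs_readout_sub_curl_le V α z S hη0 hη1 hV Fh hFh hFha g hg hy μ ν
    · rw [sub_self, abs_zero]; exact hε0
  -- the patched pairing IS the pairing
  have hsame : ∑ y ∈ box z S, ∑ μ, ∑ ν, σ y μ ν * F' y μ ν = ∑ y ∈ box z S, ∑ μ, ∑ ν, σ y μ ν * Fh y μ ν := by
    refine Finset.sum_congr rfl fun y _ => Finset.sum_congr rfl fun μ _ => Finset.sum_congr rfl fun ν _ => ?_
    rw [hF']
    split_ifs with hy
    · rfl
    · rw [hσ0 y hy μ ν, zero_mul, zero_mul]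
  -- KNIT-B
  have hB := sq_half_sum_mul_le σ F' g dg δσ z S hanti hσ0 hdg hδσ hF'row
  rw [hsame] at hB
  -- `g² ≤ 16·‖↑V − 1‖²`
  have hg2 : ∑ y ∈ box z S, ∑ ν, |δσ y ν| * g y ν ^ 2 ≤
      16 * ∑ y ∈ box z S, ∑ ν, |δσ y ν| *
        ‖((V ⟨castSite y, ν⟩ : Matrix.specialUnitaryGroup (Fin 2) ℂ) : Matrix (Fin 2) (Fin 2) ℂ) - 1‖ ^ 2 := by
    rw [Finset.mul_sum]
    refine Finset.sum_le_sum fun y _ => ?_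
    rw [Finset.mul_sum]
    refine Finset.sum_le_sum fun ν _ => ?_
    have h16 := sq_re_trace_pauli_mul_le α (((V ⟨castSite y, ν⟩ : Matrix.specialUnitaryGroup (Fin 2) ℂ) : Matrix (Fin 2) (Fin 2) ℂ) - 1)
    rw [← hg] at h16
    have ha : 0 ≤ |δσ y ν| := abs_nonneg _
    nlinarith [ha, h16]
  have hW0 : 0 ≤ ∑ y ∈ box z S, ∑ ν, |δσ y ν| := Finset.sum_nonneg fun _ _ => Finset.sum_nonneg fun _ _ => abs_nonneg _
  set X := ∑ y ∈ box z S, ∑ μ, ∑ ν, σ y μ ν * Fh y μ ν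
  set W := ∑ y ∈ box z S, ∑ ν, |δσ y ν|
  set G := ∑ y ∈ box z S, ∑ ν, |δσ y ν| * g y ν ^ 2
  set N := ∑ y ∈ box z S, ∑ ν, |δσ y ν| *
    ‖((V ⟨castSite y, ν⟩ : Matrix.specialUnitaryGroup (Fin 2) ℂ) : Matrix (Fin 2) (Fin 2) ℂ) - 1‖ ^ 2
  set E := 44 * η ^ 2 * ∑ y ∈ box z S, ∑ μ, ∑ ν, |σ y μ ν|
  have h4 : X ^ 2 = 4 * ((1 / 2) * X) ^ 2 := by ring
  have hWG : W * G ≤ W * (16 * N) := mul_le_mul_of_nonneg_left hg2 hW0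
  rw [h4]
  nlinarith [hB, hWG]

/-! ## §4 The collar term in the pen's dressing-box context -/

/-- The bonds `⟨castSite y, κ⟩`, `y ∈ Q_{3R+2}(z₀)`, lie in `boxBonds lo hi` for the dressing box `lo = z₀ − (3R+2)`, `hi = z₀ + (3R+4)`. [folklore] -/
theorem castSite_mem_boxBonds_of_mem_box {lo hi : Fin P.d → ℤ} (z₀ : Zd P.d) (R : ℕ)
    (hlo : ∀ κ, lo κ = z₀ κ - (3 * (R : ℤ) + 2)) (hhi : ∀ κ, hi κ = z₀ κ + (3 * (R : ℤ) + 4))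
    {y : Zd P.d} (hy : y ∈ box z₀ (3 * (R : ℤ) + 2)) (κ : Fin P.d) :
    (⟨castSite y, κ⟩ : PBond P j) ∈ boxBonds lo hi := by
  refine ⟨y, fun i => ?_, fun i => ?_, rfl⟩
  · have h := (mem_box.mp hy) i
    rw [abs_le] at h
    rw [hlo i]; linarith [h.1]
  · have h := (mem_box.mp hy) i
    rw [abs_le] at h
    have hu : (e κ : Zd P.d) i ≤ 1 := le_trans (le_abs_self _) (abs_unitVec_apply_le κ i)
    simp only [Pi.add_apply, hhi i]
    linarith [h.2]

/-- ★★★ **KNIT-E4 — THE COLLAR TERM OF (P4), ONE REAL INEQUALITY, IN THE PEN's LETTERS.**  On the `θ`-small dressing box (`PlaqSmallOn (boxPlaqs lo hi) θ U`,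
`hi ≤ lo + n`, `n < sitesPerDir`, `lo = z₀ − (3R+2)`, `hi = z₀ + (3R+4)`), with `V := U^{axialGauge U lo hi}` (bonds within `(d−1)nθ ≤ 1` of `1`,
✓`norm_gaugeAct_axialGauge_sub_one_le`), the cutoff-commutator 2-form `σ = E₁ − C₂` (antisymmetric, vanishing off `Q_{3R+1}(z₀)`), its coboundary `δ₂σ`,
and the antisymmetrised Pauli read-out `F̂^α` (two rows):
`(Σ_{y∈Q_{3R+2}(z₀)}Σ_μΣ_ν σ·F̂^α)² ≤ 128·(Σ_{Q_{3R+2}}Σ_ν|δ₂σ|)·(Σ_{Q_{3R+2}}Σ_ν |δ₂σ(y,ν)|·dist₁(V⟨castSite y,ν⟩)²) + 2·(44·((d−1)nθ)²·Σ_{Q_{3R+2}}ΣΣ|σ|)²`.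
[cite: GrossCMP1983, Thm 2.2] [cite: Balaban1985Averaging, (19) p.21] -/
theorem collar_term_sq_le_axial (U : GaugeField P j (Matrix.specialUnitaryGroup (Fin 2) ℂ)) {lo hi : Fin P.d → ℤ} {θ : ℝ} {n : ℕ}
    (hU : PlaqSmallOn (boxPlaqs lo hi) θ U) (hθ : 0 ≤ θ) (hn : ∀ κ, hi κ ≤ lo κ + n) (hnN : n < P.sitesPerDir j)
    (hsmall : ((P.d - 1 : ℕ) : ℝ) * n * θ ≤ 1) (z₀ : Zd P.d) (R : ℕ)
    (hlo : ∀ κ, lo κ = z₀ κ - (3 * (R : ℤ) + 2)) (hhi : ∀ κ, hi κ = z₀ κ + (3 * (R : ℤ) + 4))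
    (σ : Zd P.d → Fin P.d → Fin P.d → ℝ) (δσ : Zd P.d → Fin P.d → ℝ)
    (hanti : ∀ x μ ν, σ x ν μ = -σ x μ ν) (hσ0 : ∀ y ∉ box z₀ (3 * (R : ℤ) + 1), ∀ μ ν, σ y μ ν = 0)
    (hδσ : ∀ y ν, δσ y ν = ∑ μ, (σ (y - unitVec μ) μ ν - σ y μ ν))
    (α : Fin 3) (Fh : Zd P.d → Fin P.d → Fin P.d → ℝ)
    (hFh : ∀ y (μ ν : Fin P.d) (h : μ < ν), Fh y μ ν =
      ((I • pauli α) * (((GaugeField.plaqHol (GaugeField.gaugeAct (axialGauge U lo hi) U) ⟨castSite y, μ, ν, h⟩ :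
        Matrix.specialUnitaryGroup (Fin 2) ℂ) : Matrix (Fin 2) (Fin 2) ℂ) - 1)).trace.re)
    (hFha : ∀ y μ ν, Fh y ν μ = -Fh y μ ν) :
    (∑ y ∈ box z₀ (3 * (R : ℤ) + 2), ∑ μ, ∑ ν, σ y μ ν * Fh y μ ν) ^ 2
      ≤ 128 * ((∑ y ∈ box z₀ (3 * (R : ℤ) + 2), ∑ ν, |δσ y ν|) *
            ∑ y ∈ box z₀ (3 * (R : ℤ) + 2), ∑ ν, |δσ y ν| * GaugeGroup.dist1 (GaugeField.gaugeAct (axialGauge U lo hi) U ⟨castSite y, ν⟩) ^ 2)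
        + 2 * (44 * (((P.d - 1 : ℕ) : ℝ) * n * θ) ^ 2 * ∑ y ∈ box z₀ (3 * (R : ℤ) + 2), ∑ μ, ∑ ν, |σ y μ ν|) ^ 2 := by
  have hη0 : 0 ≤ ((P.d - 1 : ℕ) : ℝ) * n * θ := by positivity
  have hV : ∀ x ∈ box z₀ (3 * (R : ℤ) + 2), ∀ κ,
      ‖((GaugeField.gaugeAct (axialGauge U lo hi) U ⟨castSite x, κ⟩ : Matrix.specialUnitaryGroup (Fin 2) ℂ) : Matrix (Fin 2) (Fin 2) ℂ) - 1‖ ≤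
        ((P.d - 1 : ℕ) : ℝ) * n * θ := fun x hx κ =>
    norm_gaugeAct_axialGauge_sub_one_le U hU hθ hn hnN (castSite_mem_boxBonds_of_mem_box z₀ R hlo hhi hx κ)
  have hσ0' : ∀ y ∉ box z₀ (3 * (R : ℤ) + 2 - 1), ∀ μ ν, σ y μ ν = 0 := fun y hy μ ν =>
    hσ0 y (by rwa [show 3 * (R : ℤ) + 2 - 1 = 3 * (R : ℤ) + 1 by ring] at hy) μ ν
  have h := collar_term_sq_le (GaugeField.gaugeAct (axialGauge U lo hi) U) α σ δσ z₀ (3 * (R : ℤ) + 2) hη0 hsmall hanti hσ0' hδσ hV Fh hFh hFha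
  simp only [FederbushMean.dist1_SU_eq]
  exact h


/-! ## §5 The `σ`-rows from the pen's defining letters, and the closer -/

/-- `σ := E₁ − C₂` is antisymmetric in `(μ, ν)`: `E₁` by its form, `C₂` because `γt = d₂βt` is antisymmetric in its last two indices for antisymmetric `βt`
(✓`dTwo_swap_right`). [folklore] -/
theorem sigma_antisymm {d : ℕ} (βt : Zd d → Fin d → Fin d → ℝ) (at' : Zd d → Fin d → ℝ) (γt : Zd d → Fin d → Fin d → Fin d → ℝ) (χ : Zd d → ℝ)
    (E1 C2 σ : Zd d → Fin d → Fin d → ℝ)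
    (hβanti : ∀ x μ ν, βt x ν μ = -βt x μ ν)
    (hγt : ∀ x κ μ ν, γt x κ μ ν = (βt (x + unitVec κ) μ ν - βt x μ ν) - (βt (x + unitVec μ) κ ν - βt x κ ν) + (βt (x + unitVec ν) κ μ - βt x κ μ))
    (hE1 : ∀ x μ ν, E1 x μ ν = (χ (x + unitVec μ) - χ x) * at' (x + unitVec μ) ν - (χ (x + unitVec ν) - χ x) * at' (x + unitVec ν) μ)
    (hC2 : ∀ x μ ν, C2 x μ ν = ∑ κ, (χ x - χ (x - unitVec κ)) * γt (x - unitVec κ) κ μ ν)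
    (hσ : ∀ x μ ν, σ x μ ν = E1 x μ ν - C2 x μ ν) (x : Zd d) (μ ν : Fin d) :
    σ x ν μ = -σ x μ ν := by
  have hE : E1 x ν μ = -E1 x μ ν := by rw [hE1, hE1]; ring
  have hC : C2 x ν μ = -C2 x μ ν := by
    rw [hC2, hC2, ← Finset.sum_neg_distrib]
    refine Finset.sum_congr rfl fun κ _ => ?_
    rw [dTwo_swap_right βt γt hγt hβanti (x - unitVec κ) κ μ ν]; ring
  rw [hσ, hσ, hE, hC]; ring

/-- ★ `σ := E₁ − C₂` VANISHES OFF `Q_{3R+1}(z₀)` when the cutoff `χ` vanishes off `Q_{3R}(z₀)`: both commutators see `χ` only at `x`, `x + e_μ`, `x − e_κ`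
(✓`curl_comm_eq_zero_of_not_mem_box`, ✓`bdiff_comm_eq_zero_of_not_mem_box`). [folklore] -/
theorem sigma_eq_zero_of_not_mem {d : ℕ} (z₀ : Zd d) (R : ℕ) (at' : Zd d → Fin d → ℝ) (γt : Zd d → Fin d → Fin d → Fin d → ℝ) (χ : Zd d → ℝ)
    (E1 C2 σ : Zd d → Fin d → Fin d → ℝ)
    (hχ0 : ∀ x, x ∉ box z₀ (3 * (R : ℤ)) → χ x = 0)
    (hE1 : ∀ x μ ν, E1 x μ ν = (χ (x + unitVec μ) - χ x) * at' (x + unitVec μ) ν - (χ (x + unitVec ν) - χ x) * at' (x + unitVec ν) μ)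
    (hC2 : ∀ x μ ν, C2 x μ ν = ∑ κ, (χ x - χ (x - unitVec κ)) * γt (x - unitVec κ) κ μ ν)
    (hσ : ∀ x μ ν, σ x μ ν = E1 x μ ν - C2 x μ ν) :
    ∀ y ∉ box z₀ (3 * (R : ℤ) + 1), ∀ μ ν, σ y μ ν = 0 := by
  intro y hy μ ν
  have hE : E1 y μ ν = 0 := by
    rw [hE1]; exact curl_comm_eq_zero_of_not_mem_box hχ0 hy at' μ ν
  have hC : C2 y μ ν = 0 := by
    rw [hC2]
    exact Finset.sum_eq_zero fun κ _ => bdiff_comm_eq_zero_of_not_mem_box hχ0 hy (fun x => γt x κ μ ν) κ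
  rw [hσ, hE, hC, sub_zero]

/-- ★★★ **KNIT-E4 CLOSER — THE COLLAR TERM IN THE SKELETON's RAW LETTERS** (`βt` antisymmetric, `γt = d₂βt`, `χ = 0` off `Q_{3R}(z₀)`, `E₁`, `C₂`, `σ := E₁ − C₂`, `δ₂σ`;
the dressing box and `θ`-smallness as in §4): §4 with `hanti`∕`hσ0` discharged by §5.
`(Σ_{Q_{3R+2}(z₀)}ΣμΣν σ·F̂^α)² ≤ 128·(Σ_{Q_{3R+2}}Σ_ν|δ₂σ|)·(Σ_{Q_{3R+2}}Σ_ν |δ₂σ(y,ν)|·dist₁(V⟨castSite y,ν⟩)²) + 2·(44·((d−1)nθ)²·Σ_{Q_{3R+2}}ΣΣ|σ|)²`.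
[cite: GrossCMP1983, Thm 2.2] [cite: Balaban1985Averaging, (19) p.21] -/
theorem collar_term_sq_le_of_letters (U : GaugeField P j (Matrix.specialUnitaryGroup (Fin 2) ℂ)) {lo hi : Fin P.d → ℤ} {θ : ℝ} {n : ℕ}
    (hU : PlaqSmallOn (boxPlaqs lo hi) θ U) (hθ : 0 ≤ θ) (hn : ∀ κ, hi κ ≤ lo κ + n) (hnN : n < P.sitesPerDir j)
    (hsmall : ((P.d - 1 : ℕ) : ℝ) * n * θ ≤ 1) (z₀ : Zd P.d) (R : ℕ)
    (hlo : ∀ κ, lo κ = z₀ κ - (3 * (R : ℤ) + 2)) (hhi : ∀ κ, hi κ = z₀ κ + (3 * (R : ℤ) + 4))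
    (βt : Zd P.d → Fin P.d → Fin P.d → ℝ) (at' : Zd P.d → Fin P.d → ℝ) (γt : Zd P.d → Fin P.d → Fin P.d → Fin P.d → ℝ) (χ : Zd P.d → ℝ)
    (E1 C2 σ : Zd P.d → Fin P.d → Fin P.d → ℝ) (δσ : Zd P.d → Fin P.d → ℝ)
    (hβanti : ∀ x μ ν, βt x ν μ = -βt x μ ν)
    (hγt : ∀ x κ μ ν, γt x κ μ ν = (βt (x + unitVec κ) μ ν - βt x μ ν) - (βt (x + unitVec μ) κ ν - βt x κ ν) + (βt (x + unitVec ν) κ μ - βt x κ μ))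
    (hχ0 : ∀ x, x ∉ box z₀ (3 * (R : ℤ)) → χ x = 0)
    (hE1 : ∀ x μ ν, E1 x μ ν = (χ (x + unitVec μ) - χ x) * at' (x + unitVec μ) ν - (χ (x + unitVec ν) - χ x) * at' (x + unitVec ν) μ)
    (hC2 : ∀ x μ ν, C2 x μ ν = ∑ κ, (χ x - χ (x - unitVec κ)) * γt (x - unitVec κ) κ μ ν)
    (hσ : ∀ x μ ν, σ x μ ν = E1 x μ ν - C2 x μ ν)
    (hδσ : ∀ y ν, δσ y ν = ∑ μ, (σ (y - unitVec μ) μ ν - σ y μ ν))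
    (α : Fin 3) (Fh : Zd P.d → Fin P.d → Fin P.d → ℝ)
    (hFh : ∀ y (μ ν : Fin P.d) (h : μ < ν), Fh y μ ν =
      ((I • pauli α) * (((GaugeField.plaqHol (GaugeField.gaugeAct (axialGauge U lo hi) U) ⟨castSite y, μ, ν, h⟩ :
        Matrix.specialUnitaryGroup (Fin 2) ℂ) : Matrix (Fin 2) (Fin 2) ℂ) - 1)).trace.re)
    (hFha : ∀ y μ ν, Fh y ν μ = -Fh y μ ν) :
    (∑ y ∈ box z₀ (3 * (R : ℤ) + 2), ∑ μ, ∑ ν, σ y μ ν * Fh y μ ν) ^ 2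
      ≤ 128 * ((∑ y ∈ box z₀ (3 * (R : ℤ) + 2), ∑ ν, |δσ y ν|) *
            ∑ y ∈ box z₀ (3 * (R : ℤ) + 2), ∑ ν, |δσ y ν| * GaugeGroup.dist1 (GaugeField.gaugeAct (axialGauge U lo hi) U ⟨castSite y, ν⟩) ^ 2)
        + 2 * (44 * (((P.d - 1 : ℕ) : ℝ) * n * θ) ^ 2 * ∑ y ∈ box z₀ (3 * (R : ℤ) + 2), ∑ μ, ∑ ν, |σ y μ ν|) ^ 2 :=
  collar_term_sq_le_axial U hU hθ hn hnN hsmall z₀ R hlo hhi σ δσ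
    (sigma_antisymm βt at' γt χ E1 C2 σ hβanti hγt hE1 hC2 hσ) (sigma_eq_zero_of_not_mem z₀ R at' γt χ E1 C2 σ hχ0 hE1 hC2 hσ) hδσ α Fh hFh hFha

end Summit.QuantumFields.YangMills.Theorems.GrossTransferStubLinTestCollarTerm

end
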